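import Literature.Topology.FourManifolds.TautFoliationsNovikov
import HarnessLib

/-!
# Product foliations `S × S¹` by the slices `S × {θ}`: tautness and Novikov's conclusion

Sibling of `TautFoliationsProductSpheres.lean` (the product foliation of `S² × S¹` by spheres,
`Foliation.productSpheres`) and `TautFoliationsNovikov.lean` (the named fact
`Literature.Topology.FourManifolds.Foliation.fundamentalGroup_map_injective_of_isTaut`, Novikov's theorem: compact leaves of
transversely oriented taut `C⁰` foliations of closed oriented 3-manifolds are `π₁`-injective).
The check of that statement in `TautFoliationsNovikov.lean`
(`fundamentalGroup_map_injective_productSpheres`) concerns sphere leaves, for which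
`π₁`-injectivity is empty of content. This file generalises the construction to the product
foliation of `S × S¹` by the slices `S × {θ}` for *any* space `S` with an atlas of charts onto
`ℝ²`, and proves, with complete proofs:

* `Foliation.prodCircle A hA hcov` (**definition**): the `C⁰` foliated atlas of `S × 𝕊¹` with
  flow boxes `c.prod d`, `c ∈ A` a chart of `S` onto `𝔼 2`, `d` one of the two oriented circle
  charts (`circleCharts`); `isTransverselyOriented_prodCircle`, `leaf_prodCircle` (for
  preconnected `S` the leaves are the slices `S × {θ}` — chains of charts of `S` join any two
  points, `eqvGen_chartRel`), `isClosedTransversal_sliceLoop` (`{q} × S¹` is a closed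
  transversal), `isTaut_prodCircle` (**proved**).
* `Foliation.fundamentalGroup_map_injective_prodCircle` (**proved**): **Novikov's conclusion
  holds for every product foliation** — the inclusion of each leaf `S × {θ} ↪ S × S¹` is
  `π₁`-injective, because `(a, w) ↦ (a, θ)` retracts `S × S¹` onto the leaf (Hatcher,
  *Algebraic Topology* (2002), §1.1, Prop. 1.17: a retract induces an injection on `π₁`).
* `Foliation.torusCharts`, `Foliation.productTori` (**definitions**): the four product charts of
  the torus `𝕊¹ × 𝕊¹` onto `𝔼 2` and the resulting **foliation of the 3-torus
  `(𝕊¹ × 𝕊¹) × 𝕊¹` by the tori `T² × {θ}`**; `productTori_isTransverselyOriented_isTaut`,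
  `isCompact_leaf_productTori` and `fundamentalGroup_map_injective_productTori` (**proved**):
  it is a transversely oriented taut foliation of a closed connected oriented 3-manifold
  (`isOrientable_torusThree`) with compact leaves — so **the hypotheses of Novikov's theorem
  are met by a foliation whose leaves are tori**, with `π₁(T²) ≅ ℤ²`, and its conclusion holds
  for it (`fundamentalGroup_map_injective_of_isTaut_productTori`; and
  `fundamentalGroup_map_injective_of_isTaut_apply_productTori`: the named fact instantiates on
  the 3-torus, all its typeclass hypotheses being available).

## References

* G. Hector, U. Hirsch, *Introduction to the Geometry of Foliations, Part A* (1986), Ch. II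
  2.1.7 (i) (horizontal foliation of a product), 2.2.9 (iii) (closed transversals)
  [HectorHirsch1986].
* A. Hatcher, *Algebraic Topology*, CUP (2002), §1.1, Prop. 1.17 [HatcherAT2002].
* D. Gabai, *Foliations and the topology of 3-manifolds*, J. Differential Geom. 18 (1983),
  Thm. 2.8 (4), Example before Def. 2.11 [Gabai1983].

## Design notes

* The circle factor, its two oriented charts `northChart`, `southChart` (onto `ℝ`, increasing
  change of charts) and the loop `loopPt` are those of `TautFoliationsProductSpheres.lean`;
  only the first factor is generalised. `ℝ × ℝ` is identified with `𝔼 2` through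
  `EuclideanSpace.equiv` and `Homeomorph.piFinTwo`.
* Notation `𝔼 n`, `𝕊 n` is local, as in the sibling files.
-/

open scoped Manifold ContDiff Topology Real
open Function Set Filter

noncomputable section

namespace Literature.Topology.FourManifolds

/-- Local notation: `𝔼 n` is the model Euclidean space `EuclideanSpace ℝ (Fin n)`. -/
local notation "𝔼 " n:arg => EuclideanSpace ℝ (Fin n)

/-- Local notation: `𝕊 n` is the unit sphere in `EuclideanSpace ℝ (Fin (n + 1))`, the standard
`n`-sphere with its Mathlib manifold structure. -/
local notation "𝕊 " n:arg => (Metric.sphere (0 : EuclideanSpace ℝ (Fin (n + 1))) 1)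

namespace Foliation

variable {S : Type*} [TopologicalSpace S]

/-! ## The product foliation of `S × S¹` by slices -/

/-- The **product foliation of `S × S¹` by the slices `S × {θ}`** (the horizontal foliation of
the product, Hector–Hirsch A, Ch. II 2.1.7 (i)), as a `C⁰` foliated atlas: given an atlas `A` of
homeomorphisms from open subsets of `S` onto `𝔼 2` covering `S`, the flow boxes are the
products `c.prod d` with `c ∈ A` and `d` one of the two oriented circle charts; the height of a
point is its circle coordinate. [folklore] -/
def prodCircle (A : Set (OpenPartialHomeomorph S (𝔼 2))) (hA : ∀ c ∈ A, c.target = univ)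
    (hcov : ∀ a : S, ∃ c ∈ A, a ∈ c.source) : Foliation (𝔼 2) (S × (𝕊 1)) where
  atlas := {e | ∃ c ∈ A, ∃ d ∈ circleCharts, e = c.prod d}
  target_eq := by
    rintro e ⟨c, hc, d, hd, rfl⟩
    rw [OpenPartialHomeomorph.prod_target, hA c hc, target_eq_of_mem_circleCharts hd,
      univ_prod_univ]
  exists_mem_source x := by
    obtain ⟨c, hc, hxc⟩ := hcov x.1
    obtain ⟨d, hd, hxd⟩ := exists_mem_circleCharts_source x.2
    refine ⟨c.prod d, ⟨c, hc, d, hd, rfl⟩, ?_⟩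
    rw [OpenPartialHomeomorph.prod_source]
    exact ⟨hxc, hxd⟩
  locally_plaque := by
    rintro e ⟨c, hc, d, hd, rfl⟩ e' ⟨c', hc', d', hd', rfl⟩ x -
    refine ⟨univ, Filter.univ_mem, ?_⟩
    rintro y ⟨-, hy, -⟩ z ⟨-, hz, -⟩ h
    rw [OpenPartialHomeomorph.prod_source] at hy hz
    simp only [OpenPartialHomeomorph.prod_apply] at h ⊢
    rw [d.injOn hy.2 hz.2 h]

variable {A : Set (OpenPartialHomeomorph S (𝔼 2))} {hA : ∀ c ∈ A, c.target = univ}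
  {hcov : ∀ a : S, ∃ c ∈ A, a ∈ c.source}

/-- The product foliation is transversely oriented (the change of circle charts `t ↦ -4/t` is
increasing, `circleCharts_locally_increasing`). [folklore] -/
theorem isTransverselyOriented_prodCircle : (prodCircle A hA hcov).IsTransverselyOriented := by
  rintro e ⟨c, hc, d, hd, rfl⟩ e' ⟨c', hc', d', hd', rfl⟩ x hx
  rw [OpenPartialHomeomorph.prod_source, OpenPartialHomeomorph.prod_source] at hx
  obtain ⟨V, hV, hmono⟩ := circleCharts_locally_increasing hd hd' (w₀ := x.2) ⟨hx.1.2, hx.2.2⟩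
  refine ⟨Prod.snd ⁻¹' V, continuous_snd.continuousAt.preimage_mem_nhds hV, ?_⟩
  rintro y ⟨hyV, hy⟩ z ⟨hzV, hz⟩ h
  rw [OpenPartialHomeomorph.prod_source, OpenPartialHomeomorph.prod_source] at hy hz
  exact hmono y.2 ⟨hyV, hy.1.2, hy.2.2⟩ z.2 ⟨hzV, hz.1.2, hz.2.2⟩ h

/-- **In a preconnected space any two points are joined by a chain of chart domains** of a
covering family of charts: the set of points chain-related to `a` is open and closed.
[folklore] -/
theorem eqvGen_chartRel [PreconnectedSpace S] (hcov : ∀ a : S, ∃ c ∈ A, a ∈ c.source)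
    (a b : S) :
    Relation.EqvGen (fun a b : S ↦ ∃ c ∈ A, a ∈ c.source ∧ b ∈ c.source) a b := by
  set T : Set S := {b | Relation.EqvGen (fun a b : S ↦ ∃ c ∈ A, a ∈ c.source ∧ b ∈ c.source) a b}
    with hT
  -- a chart domain meeting `T` lies in `T`
  have hstep : ∀ {c : OpenPartialHomeomorph S (𝔼 2)} {u v : S}, c ∈ A → u ∈ c.source →
      v ∈ c.source → u ∈ T → v ∈ T := fun hc hu hv huT ↦
    Relation.EqvGen.trans _ _ _ huT (Relation.EqvGen.rel _ _ ⟨_, hc, hu, hv⟩)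
  have hopen : IsOpen T := by
    rw [isOpen_iff_mem_nhds]
    intro u hu
    obtain ⟨c, hc, huc⟩ := hcov u
    exact mem_of_superset (c.open_source.mem_nhds huc) fun v hv ↦ hstep hc huc hv hu
  have hclosed : IsClosed T := by
    rw [← isOpen_compl_iff, isOpen_iff_mem_nhds]
    intro u hu
    obtain ⟨c, hc, huc⟩ := hcov u
    exact mem_of_superset (c.open_source.mem_nhds huc) fun v hv hvT ↦ hu (hstep hc hv huc hvT)
  have huniv : T = univ :=
    (isClopen_iff.1 ⟨hclosed, hopen⟩).resolve_left (Set.nonempty_iff_ne_empty.1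
      ⟨a, Relation.EqvGen.refl a⟩)
  have hb : b ∈ T := huniv ▸ mem_univ b
  exact hb

/-- **The leaves of the product foliation of `S × S¹` are the slices `S × {θ}`** (for
preconnected `S`): within a flow box the height is the circle coordinate, so plaques lie in
slices; conversely two points of a slice are joined by a chain of plaques over a chain of chart
domains of `S` (`eqvGen_chartRel`). [folklore] -/
theorem leaf_prodCircle [PreconnectedSpace S] (x : S × (𝕊 1)) :
    (prodCircle A hA hcov).leaf x = {y | y.2 = x.2} := by
  ext y
  simp only [mem_leaf_iff, mem_setOf_eq]
  constructor
  · intro h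
    induction h with
    | rel a b hab =>
      obtain ⟨e, ⟨c, hc, d, hd, rfl⟩, ha, hb, h⟩ := hab
      rw [OpenPartialHomeomorph.prod_source] at ha hb
      exact (d.injOn ha.2 hb.2 h).symm
    | refl a => rfl
    | symm a b _ ih => exact ih.symm
    | trans a b c _ _ ih₁ ih₂ => exact ih₂.trans ih₁
  · intro h
    obtain ⟨d, hd, hxd⟩ := exists_mem_circleCharts_source x.2
    -- transport a chain of chart domains of `S` to a chain of plaques at height `x.2`
    have key : ∀ {a b : S},
        Relation.EqvGen (fun a b : S ↦ ∃ c ∈ A, a ∈ c.source ∧ b ∈ c.source) a b →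
        Relation.EqvGen (prodCircle A hA hcov).SamePlaque (a, x.2) (b, x.2) := by
      intro a b hab
      induction hab with
      | rel a b hab =>
        obtain ⟨c, hc, hac, hbc⟩ := hab
        refine Relation.EqvGen.rel _ _ ⟨c.prod d, ⟨c, hc, d, hd, rfl⟩, ?_, ?_, rfl⟩
        · rw [OpenPartialHomeomorph.prod_source]
          exact ⟨hac, hxd⟩
        · rw [OpenPartialHomeomorph.prod_source]
          exact ⟨hbc, hxd⟩
      | refl a => exact Relation.EqvGen.refl _
      | symm a b _ ih => exact Relation.EqvGen.symm _ _ ih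
      | trans a b c _ _ ih₁ ih₂ => exact Relation.EqvGen.trans _ _ _ ih₁ ih₂
    have hy : y = (y.1, x.2) := Prod.ext rfl h
    rw [hy, show x = (x.1, x.2) from rfl]
    exact key (eqvGen_chartRel hcov x.1 y.1)

/-- The leaves of the product foliation of `S × S¹` are compact when `S` is compact and
preconnected. [folklore] -/
theorem isCompact_leaf_prodCircle [PreconnectedSpace S] [CompactSpace S] (x : S × (𝕊 1)) :
    IsCompact ((prodCircle A hA hcov).leaf x) := by
  have hleaf : (prodCircle A hA hcov).leaf x = range (fun a : S ↦ (a, x.2)) := by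
    rw [leaf_prodCircle]
    ext y
    simp only [mem_setOf_eq, mem_range]
    exact ⟨fun h ↦ ⟨y.1, Prod.ext rfl h.symm⟩, fun ⟨q, hq⟩ ↦ hq ▸ rfl⟩
  rw [hleaf]
  exact isCompact_range (continuous_id.prodMk continuous_const)

/-! ## Closed transversals `{q} × S¹`; tautness -/

/-- **`{q} × S¹` is a closed transversal** of the product foliation of `S × S¹`: near each
parameter the loop `s ↦ (q, loopPt s)` runs in a product box `c.prod northChart` or
`c.prod southChart` (`c ∋ q`) with strictly increasing height
(`strictMonoOn_northChart_loopPt`, `strictMonoOn_southChart_loopPt`). [folklore] -/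
theorem isClosedTransversal_sliceLoop (q : S) :
    (prodCircle A hA hcov).IsClosedTransversal (fun s ↦ (q, loopPt s)) := by
  refine ⟨continuous_const.prodMk continuous_loopPt, fun s ↦ ?_, fun s ↦ ?_⟩
  · simp only [loopPt_add_one]
  obtain ⟨c, hc, hqc⟩ := hcov q
  by_cases hs : Real.cos (2 * π * s) < 1 / 2
  · obtain ⟨ε, hε, hI⟩ := exists_Ioo_cos_lt hs
    have hI' : ∀ r ∈ Ioo (s - ε) (s + ε), Real.cos (2 * π * r) ≠ 1 := fun r hr h1 ↦ by
      have := hI r hr; rw [h1] at this; norm_num at this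
    refine ⟨c.prod northChart, ⟨c, hc, northChart, Or.inl rfl, rfl⟩, ε, hε,
      fun r hr ↦ ?_, Or.inl (strictMonoOn_northChart_loopPt hI')⟩
    rw [OpenPartialHomeomorph.prod_source]
    refine ⟨hqc, ?_⟩
    show ((loopPt r : 𝕊 1) : 𝔼 2) 1 ≠ 1
    rw [loopPt_apply_one]
    exact hI' r hr
  · obtain ⟨ε, hε, hI⟩ :=
      exists_Ioo_lt_cos (show -(1 / 2 : ℝ) < Real.cos (2 * π * s) by linarith [not_lt.1 hs])
    have hI' : ∀ r ∈ Ioo (s - ε) (s + ε), Real.cos (2 * π * r) ≠ -1 := fun r hr h1 ↦ by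
      have := hI r hr; rw [h1] at this; norm_num at this
    refine ⟨c.prod southChart, ⟨c, hc, southChart, Or.inr rfl, rfl⟩, ε, hε,
      fun r hr ↦ ?_, Or.inl (strictMonoOn_southChart_loopPt hI')⟩
    rw [OpenPartialHomeomorph.prod_source, southChart_source]
    refine ⟨hqc, ?_⟩
    show ((loopPt r : 𝕊 1) : 𝔼 2) 1 ≠ -1
    rw [loopPt_apply_one]
    exact hI' r hr

/-- **The product foliation of `S × S¹` is taut**: the leaf through `x` meets the closed
transversal `{x.1} × S¹` at `x`. [folklore] -/
theorem isTaut_prodCircle : (prodCircle A hA hcov).IsTaut := fun x ↦ by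
  obtain ⟨s, hs⟩ := exists_loopPt_eq x.2
  refine ⟨fun s ↦ (x.1, loopPt s), isClosedTransversal_sliceLoop x.1, s, ?_⟩
  simp only [hs, Prod.mk.eta]
  exact (prodCircle A hA hcov).mem_leaf_self x

/-! ## Novikov's conclusion for product foliations -/

/-- **The leaves of a product foliation are `π₁`-injective**: for the product foliation of
`S × S¹` by slices (`S` preconnected) and any base point `p` of the leaf `L = S × {θ}` through
`x`, the inclusion `L ↪ S × S¹` induces an injection of fundamental groups — the map
`(a, w) ↦ (a, θ)` is a retraction of `S × S¹` onto `L`, and a retract is `π₁`-injective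
(Hatcher (2002), Prop. 1.17: `r ∘ ι = id` gives `r_* ∘ ι_* = id`). This is the conclusion of
Novikov's theorem `fundamentalGroup_map_injective_of_isTaut` for these foliations.
[cite: HatcherAT2002, Prop. 1.17] -/
theorem fundamentalGroup_map_injective_prodCircle [PreconnectedSpace S] (x : S × (𝕊 1))
    (p : (prodCircle A hA hcov).leaf x) :
    Injective (FundamentalGroup.map
      (⟨Subtype.val, continuous_subtype_val⟩ : C((prodCircle A hA hcov).leaf x, S × (𝕊 1))) p) := by
  -- the retraction onto the leaf
  have hmem : ∀ a : S, (a, x.2) ∈ (prodCircle A hA hcov).leaf x := fun a ↦ by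
    rw [leaf_prodCircle]
    rfl
  let r : C(S × (𝕊 1), (prodCircle A hA hcov).leaf x) :=
    ⟨fun y ↦ ⟨(y.1, x.2), hmem y.1⟩, (continuous_fst.prodMk continuous_const).subtype_mk _⟩
  have hr : ∀ q : (prodCircle A hA hcov).leaf x, r (q : S × (𝕊 1)) = q := fun q ↦ by
    apply Subtype.ext
    have hq : (q : S × (𝕊 1)).2 = x.2 :=
      (Set.ext_iff.1 (leaf_prodCircle x) (q : S × (𝕊 1))).1 q.2
    exact Prod.ext rfl hq.symm
  set ι : C((prodCircle A hA hcov).leaf x, S × (𝕊 1)) := ⟨Subtype.val, continuous_subtype_val⟩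
  -- Mathlib's `map ι p` is `mapOfEq ι rfl`
  have hmap : FundamentalGroup.map ι p = FundamentalGroup.mapOfEq ι rfl := by
    ext c
    induction c using Quotient.ind with
    | _ γ => rw [FundamentalGroup.mapOfEq_apply]; rfl
  have key : ∀ a : FundamentalGroup ((prodCircle A hA hcov).leaf x) p,
      FundamentalGroup.mapOfEq r (hr p) (FundamentalGroup.mapOfEq ι rfl a) = a := fun a ↦ by
    rw [← FundamentalGroup.mapOfEq_comp_apply ι r rfl (hr p) a]
    exact FundamentalGroup.mapOfEq_apply_eq_self_of_forall_eq (r.comp ι) (fun q ↦ hr q) a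
  intro a b hab
  rw [hmap] at hab
  rw [← key a, ← key b, hab]

/-! ## The foliation of the 3-torus by tori -/

/-- The identification `𝔼 2 ≃ₜ ℝ × ℝ` (coordinates). [folklore] -/
def euclideanTwoHomeomorphProd : (𝔼 2) ≃ₜ ℝ × ℝ :=
  (EuclideanSpace.equiv (Fin 2) ℝ).toHomeomorph.trans (Homeomorph.piFinTwo fun _ ↦ ℝ)

/-- **The four product charts of the torus `𝕊¹ × 𝕊¹` onto `𝔼 2`**: products of two oriented
circle charts, read in `𝔼 2 ≃ ℝ × ℝ`. [folklore] -/
def torusCharts : Set (OpenPartialHomeomorph ((𝕊 1) × (𝕊 1)) (𝔼 2)) :=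
  {e | ∃ c₁ ∈ circleCharts, ∃ c₂ ∈ circleCharts,
    e = (c₁.prod c₂).transHomeomorph euclideanTwoHomeomorphProd.symm}

/-- The torus charts are onto `𝔼 2`. [folklore] -/
theorem target_eq_of_mem_torusCharts {e : OpenPartialHomeomorph ((𝕊 1) × (𝕊 1)) (𝔼 2)}
    (he : e ∈ torusCharts) : e.target = univ := by
  obtain ⟨c₁, hc₁, c₂, hc₂, rfl⟩ := he
  rw [OpenPartialHomeomorph.transHomeomorph_target, OpenPartialHomeomorph.prod_target,
    target_eq_of_mem_circleCharts hc₁, target_eq_of_mem_circleCharts hc₂, univ_prod_univ,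
    preimage_univ]

/-- The torus charts cover the torus. [folklore] -/
theorem exists_mem_torusCharts_source (a : (𝕊 1) × (𝕊 1)) : ∃ e ∈ torusCharts, a ∈ e.source := by
  obtain ⟨c₁, hc₁, h₁⟩ := exists_mem_circleCharts_source a.1
  obtain ⟨c₂, hc₂, h₂⟩ := exists_mem_circleCharts_source a.2
  refine ⟨_, ⟨c₁, hc₁, c₂, hc₂, rfl⟩, ?_⟩
  rw [OpenPartialHomeomorph.transHomeomorph_source, OpenPartialHomeomorph.prod_source]
  exact ⟨h₁, h₂⟩

/-- **The foliation of the 3-torus `T³ = (𝕊¹ × 𝕊¹) × 𝕊¹` by the tori `T² × {θ}`**: the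
product foliation `prodCircle` over the torus charts. [folklore] -/
def productTori : Foliation (𝔼 2) (((𝕊 1) × (𝕊 1)) × (𝕊 1)) :=
  prodCircle torusCharts (fun _ he ↦ target_eq_of_mem_torusCharts he) exists_mem_torusCharts_source

/-- The 3-torus `(𝕊¹ × 𝕊¹) × 𝕊¹` is connected (the circle is: `isConnected_sphere` in
dimension `2 > 1`; cf. `Literature.Topology.FourManifolds.connectedSpace_sphere_one` in `SurfaceCapping.lean`, not imported
here). [folklore] -/
theorem connectedSpace_torusThree : ConnectedSpace (((𝕊 1) × (𝕊 1)) × (𝕊 1)) := by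
  haveI : ConnectedSpace (𝕊 1) := isConnected_iff_connectedSpace.1 (isConnected_sphere (by
    rw [← Module.finrank_eq_rank, finrank_euclideanSpace_fin]; norm_num) _ zero_le_one)
  infer_instance

/-- The 2-torus `𝕊¹ × 𝕊¹` is preconnected. [folklore] -/
theorem preconnectedSpace_torusTwo : PreconnectedSpace ((𝕊 1) × (𝕊 1)) := by
  haveI : ConnectedSpace (𝕊 1) := isConnected_iff_connectedSpace.1 (isConnected_sphere (by
    rw [← Module.finrank_eq_rank, finrank_euclideanSpace_fin]; norm_num) _ zero_le_one)
  infer_instance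

/-- The leaves of the foliation of `T³` by tori are the tori `T² × {θ}`. [folklore] -/
theorem leaf_productTori (x : ((𝕊 1) × (𝕊 1)) × (𝕊 1)) :
    productTori.leaf x = {y | y.2 = x.2} := by
  haveI := preconnectedSpace_torusTwo
  exact leaf_prodCircle x

/-- The leaves of the foliation of `T³` by tori are compact. [folklore] -/
theorem isCompact_leaf_productTori (x : ((𝕊 1) × (𝕊 1)) × (𝕊 1)) :
    IsCompact (productTori.leaf x) := by
  haveI := preconnectedSpace_torusTwo
  exact isCompact_leaf_prodCircle x

/-- **The foliation of `T³` by tori is transversely oriented and taut.** [folklore] -/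
theorem productTori_isTransverselyOriented_isTaut :
    productTori.IsTransverselyOriented ∧ productTori.IsTaut :=
  ⟨isTransverselyOriented_prodCircle, isTaut_prodCircle⟩

/-- **Novikov's conclusion for the foliation of `T³` by tori**: the inclusion of each torus leaf
`T² × {θ} ↪ T³` is `π₁`-injective (`ℤ² ↪ ℤ³`), by the retraction onto the leaf.
[cite: HatcherAT2002, Prop. 1.17] -/
theorem fundamentalGroup_map_injective_productTori (x : ((𝕊 1) × (𝕊 1)) × (𝕊 1))
    (p : productTori.leaf x) :
    Injective (FundamentalGroup.map
      (⟨Subtype.val, continuous_subtype_val⟩ : C(productTori.leaf x, ((𝕊 1) × (𝕊 1)) × (𝕊 1))) p) := by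
  haveI := preconnectedSpace_torusTwo
  exact fundamentalGroup_map_injective_prodCircle x p

/-- **`T³` is orientable** (product charts, model `((𝓡 1).prod (𝓡 1)).prod (𝓡 1)`): products of
orientable manifolds are orientable (`IsOrientable.prod`) and spheres are
(`isOrientable_sphere_holds`). [folklore] -/
theorem isOrientable_torusThree :
    IsOrientable (((𝓡 1).prod (𝓡 1)).prod (𝓡 1)) (((𝕊 1) × (𝕊 1)) × (𝕊 1)) :=
  (isOrientable_sphere_prod_sphere 1 1).prod (isOrientable_sphere_holds 1)

/-- **The hypotheses of Novikov's theorem are met by the foliation of `T³` by tori, and its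
conclusion holds there**: `T³ = (𝕊¹ × 𝕊¹) × 𝕊¹` with its product charts is a closed
connected oriented 3-manifold (`isOrientable_torusThree`), `productTori` is a transversely
oriented taut `C⁰` foliation of it with compact leaves (the tori `T² × {θ}`, of fundamental
group `ℤ²`), and the named fact `fundamentalGroup_map_injective_of_isTaut` specialised to
this foliation is a theorem (`fundamentalGroup_map_injective_productTori`). In particular the
statement of Novikov's theorem is exercised, with all its hypotheses, on leaves that are not
simply connected. [folklore] -/
theorem fundamentalGroup_map_injective_of_isTaut_productTori
    (x : ((𝕊 1) × (𝕊 1)) × (𝕊 1)) (p : productTori.leaf x) :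
    (∀ (_hdim : Module.finrank ℝ ((𝔼 1 × 𝔼 1) × 𝔼 1) = 3)
      (_hM : IsOrientable (((𝓡 1).prod (𝓡 1)).prod (𝓡 1)) (((𝕊 1) × (𝕊 1)) × (𝕊 1)))
      (_ho : productTori.IsTransverselyOriented) (_ht : productTori.IsTaut)
      (_hx : IsCompact (productTori.leaf x)),
      Injective (FundamentalGroup.map
        (⟨Subtype.val, continuous_subtype_val⟩ :
          C(productTori.leaf x, ((𝕊 1) × (𝕊 1)) × (𝕊 1))) p)) ∧
    Module.finrank ℝ ((𝔼 1 × 𝔼 1) × 𝔼 1) = 3 ∧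
    IsOrientable (((𝓡 1).prod (𝓡 1)).prod (𝓡 1)) (((𝕊 1) × (𝕊 1)) × (𝕊 1)) ∧
    productTori.IsTransverselyOriented ∧ productTori.IsTaut ∧ IsCompact (productTori.leaf x) :=
  ⟨fun _ _ _ _ _ ↦ fundamentalGroup_map_injective_productTori x p, by simp,
    isOrientable_torusThree, isTransverselyOriented_prodCircle, isTaut_prodCircle,
    isCompact_leaf_productTori x⟩

/-- The named fact, applied to the foliation of `T³` by tori (a direct instantiation, recorded
to check that every typeclass hypothesis of `fundamentalGroup_map_injective_of_isTaut` —
Hausdorff, second countable, compact, connected, charted, `C^∞` manifold — is available for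
`T³`). [folklore] -/
theorem fundamentalGroup_map_injective_of_isTaut_apply_productTori
    (hN : fundamentalGroup_map_injective_of_isTaut.{0}) (x : ((𝕊 1) × (𝕊 1)) × (𝕊 1))
    (p : productTori.leaf x) :
    Injective (FundamentalGroup.map
      (⟨Subtype.val, continuous_subtype_val⟩ :
        C(productTori.leaf x, ((𝕊 1) × (𝕊 1)) × (𝕊 1))) p) := by
  haveI := connectedSpace_torusThree
  exact hN (((𝓡 1).prod (𝓡 1)).prod (𝓡 1)) (by simp) (((𝕊 1) × (𝕊 1)) × (𝕊 1))
    isOrientable_torusThree productTori isTransverselyOriented_prodCircle isTaut_prodCircle x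
    (isCompact_leaf_productTori x) p

end Foliation

end Literature.Topology.FourManifolds
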